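import Summits.QuantumAdvantage.QuantumAdvantage.Theorems.CubicForrelationNearExactIsExactFourModSixSecondSplitBudget
import Summits.QuantumAdvantage.QuantumAdvantage.Theorems.CubicForrelationNearExactIsExactSixteenSplitA

/-!
# Crux `CubicForrelation.NearExactIsExact` (stmt-QuantumAdvantage-14043) — `n = 6r+4`, TWO-SIDED, second boundary: split configuration (sA)
  is empty (`r ≥ 3`)

Certificate seat `b2b-cforr-cert` (gen 8).  HONEST FRAMING: a theorem uniform in `r` about cubic Boolean pairs on `6r+4` bits (the tree's
`n = 16` file `…SixteenSplitA.lean` in general `r`); one of the three split configurations of `f2_split_trichotomy`; NOT summit progress.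

Configuration (sA): parity `d₀ = [u odd]` affine non-constant (support `L`, a hyperplane; complement `H`), `A := H ∩ {d₁ = 1}` an
`(n−3)`-flat inside `H` (`d₁ = [⌊u/2⌋ odd]` quadratic), `B' = C' = ∅`, budget identity `2^{8r+5}(1−Φ) = N` and pointwise equality.  Then
the residual `τ = u − 2^r s` is: `(−1)^{d₁}` on `L`, `±2` on `A`, `0` on `H ∖ A`.
* `f2_H34` (general `r ≥ 2`): the engine hypotheses (H3)/(H4) for a `±1` pattern `e` on a coset `S` with `τ = 2e` on `S` and `τ = 0` on the
  translates `S ⊕ t₁, S ⊕ t₂, S ⊕ t₁ ⊕ t₂` — from `8 ∣ Σ₅ u`, `16 ∣ Σ₆ u` and Ax for `f`.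
* `f2_splitA_false`: `L`-piece `(−1)^{d₁}·1_L` has `V_A` as periods up to sign (`D_a d₁` affine, vanishing on `H`, constant on `L`) ⇒
  `Σ|·̂| ≤ 2N` (`sp_L_l1`); `A`-piece `ε·1_A` satisfies (H3)/(H4) by `f2_H34` with two directions in `V_L ∖ V_A` ⇒ `Σ|·̂| ≤ 2N` (`fl1_flat_l1`);
  so `Σ|τ̂| ≤ 6N`, but the pairing is `2^{10r+6}(1−Φ) = 2^{2r+1}N ≥ 128N`.

References: J. Ax (1964) / R. J. McEliece (1972); MacWilliams–Sloane (1977) Ch. 13–15; R. O'Donnell (2014) §3.3.  Everything below is proved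
from Mathlib and the tree; axioms are the standard three.
-/

set_option linter.dupNamespace false -- D-0017: single-problem summit ⇒ `QuantumAdvantage.QuantumAdvantage` by design

noncomputable section

namespace Summit.QuantumAdvantage.QuantumAdvantage.Theorems.CubicForrelation.NearExactIsExact

open Finset
open Literature.Computability.QuantumComplexity
open Literature.Computability.QuantumComplexity.BuzetChailloux (bxor zeroVec bxor_bxor_cancel_left bxor_zeroVec zeroVec_bxor bxor_comm
  bxor_self)
open Literature.Computability.QuantumComplexity.DerivativeWalsh (W)

/-- **The engine hypotheses from flat sums (`6r+4` bits, `r ≥ 2`).**  `f, g` cubic, `W_g = 2^{2r+2}u`, `S = x₁ ⊕ V₀` a coset,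
`u − 2^r(−1)^f = 2e` on `S`, and two directions `t₁, t₂` such that `u − 2^r(−1)^f` vanishes on `S ⊕ t₁`, `S ⊕ t₂`, `S ⊕ t₂ ⊕ t₁`.  Then every
parametrised 3-flat sum of `e` inside `S` is `≡ 0 (mod 4)` and every parametrised 4-flat sum is `≡ 0 (mod 8)`. [this work] -/
theorem f2_H34 (r : ℕ) (hr : 2 ≤ r) (f g : (Fin ((3 * r + 2) + (3 * r + 2)) → Bool) → Bool) (hf : IsDegLeFun 3 f) (hg : IsDegLeFun 3 g)
    (u : (Fin ((3 * r + 2) + (3 * r + 2)) → Bool) → ℤ) (hu : ∀ x, W (fun y => signOf (g y)) x = (2 : ℝ) ^ (2 * r + 2) * (u x : ℝ))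
    (V₀ S : Finset (Fin ((3 * r + 2) + (3 * r + 2)) → Bool)) (x₁ : Fin ((3 * r + 2) + (3 * r + 2)) → Bool) (h0 : zeroVec ∈ V₀)
    (hadd : ∀ a ∈ V₀, ∀ b ∈ V₀, bxor a b ∈ V₀) (hS : S = V₀.image (bxor x₁)) (e : (Fin ((3 * r + 2) + (3 * r + 2)) → Bool) → ℤ)
    (t₁ t₂ : Fin ((3 * r + 2) + (3 * r + 2)) → Bool) (hFe : ∀ p ∈ S, u p - 2 ^ r * sZ (f p) = 2 * e p)
    (hz1 : ∀ p ∈ S, u (bxor p t₁) - 2 ^ r * sZ (f (bxor p t₁)) = 0)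
    (hz2 : ∀ p ∈ S, u (bxor p t₂) - 2 ^ r * sZ (f (bxor p t₂)) = 0)
    (hz21 : ∀ p ∈ S, u (bxor (bxor p t₂) t₁) - 2 ^ r * sZ (f (bxor (bxor p t₂) t₁)) = 0) :
    (∀ x ∈ S, ∀ a b c : Fin ((3 * r + 2) + (3 * r + 2)) → Bool, a ∈ V₀ → b ∈ V₀ → c ∈ V₀ →
      (4 : ℤ) ∣ ∑ ε : Fin 3 → Bool, e (fun j => x j ^^ decide (Odd #(univ.filter fun i =>
        ε i && (![a, b, c] : Fin 3 → Fin ((3 * r + 2) + (3 * r + 2)) → Bool) i j)))) ∧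
    (∀ x ∈ S, ∀ a₀ a₁ a₂ a₃ : Fin ((3 * r + 2) + (3 * r + 2)) → Bool, a₀ ∈ V₀ → a₁ ∈ V₀ → a₂ ∈ V₀ → a₃ ∈ V₀ →
      (8 : ℤ) ∣ ∑ ε : Fin 4 → Bool, e (fun j => x j ^^ decide (Odd #(univ.filter fun i =>
        ε i && (![a₀, a₁, a₂, a₃] : Fin 4 → Fin ((3 * r + 2) + (3 * r + 2)) → Bool) i j)))) := by
  classical
  obtain ⟨k, rfl⟩ : ∃ k, r = k + 2 := ⟨r - 2, by omega⟩
  have hPV : ∀ x, x ∈ S → ∀ a ∈ V₀, bxor x a ∈ S := fun x hx a ha => fl1_coset_vadd hadd hS hx ha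
  have hloc : ∀ {kk : ℕ} (x : Fin ((3 * (k + 2) + 2) + (3 * (k + 2) + 2)) → Bool)
      (a : Fin kk → Fin ((3 * (k + 2) + 2) + (3 * (k + 2) + 2)) → Bool),
      (∀ ε : Fin kk → Bool, (fun j => x j ^^ decide (Odd #(univ.filter fun i => ε i && a i j))) ∈ S) →
      ∑ ε : Fin (kk + 2) → Bool, (u (fun j => x j ^^ decide (Odd #(univ.filter fun i =>
          ε i && (Matrix.vecCons t₁ (Matrix.vecCons t₂ a) : Fin (kk + 2) → Fin ((3 * (k + 2) + 2) + (3 * (k + 2) + 2)) → Bool) i j))) -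
        2 ^ (k + 2) * sZ (f (fun j => x j ^^ decide (Odd #(univ.filter fun i =>
          ε i && (Matrix.vecCons t₁ (Matrix.vecCons t₂ a) : Fin (kk + 2) → Fin ((3 * (k + 2) + 2) + (3 * (k + 2) + 2)) → Bool) i j))))) =
      ∑ ε : Fin kk → Bool, 2 * e (fun j => x j ^^ decide (Odd #(univ.filter fun i => ε i && a i j))) := by
    intro kk x a hin
    have key := sp_loc2 (fun y => u y - 2 ^ (k + 2) * sZ (f y)) x t₁ t₂ a (fun ε => hz1 _ (hin ε)) (fun ε => hz2 _ (hin ε))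
      (fun ε => hz21 _ (hin ε))
    beta_reduce at key
    rw [key]
    exact sum_congr rfl fun ε _ => hFe _ (hin ε)
  refine ⟨?_, ?_⟩
  · intro x hx a b c ha hb hc
    have hin : ∀ ε : Fin 3 → Bool, (fun j => x j ^^ decide (Odd #(univ.filter fun i =>
        ε i && (![a, b, c] : Fin 3 → Fin ((3 * (k + 2) + 2) + (3 * (k + 2) + 2)) → Bool) i j))) ∈ S :=
      fun ε => fr_mem_flatPt3 V₀ h0 (· ∈ S) hPV hx ![a, b, c] (fun i => by fin_cases i <;> assumption) ε
    have h8 := fs_flat_sum_dvd (e := 3) g u hg hu x ![t₁, t₂, a, b, c] (by omega)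
    obtain ⟨zf, hzf⟩ := sl_sum_sZ_flat f hf x ![t₁, t₂, a, b, c]
    have hzf' : ∑ ε : Fin 5 → Bool, 2 ^ (k + 2) * sZ (f (fun j => x j ^^ decide (Odd #(univ.filter fun i =>
          ε i && (![t₁, t₂, a, b, c] : Fin 5 → Fin ((3 * (k + 2) + 2) + (3 * (k + 2) + 2)) → Bool) i j)))) =
        8 * (2 ^ (k + 1) * zf) := by
      rw [← mul_sum, hzf]; norm_num; ring
    have h8n : (8 : ℤ) ∣ ∑ ε : Fin 5 → Bool, u (fun j => x j ^^ decide (Odd #(univ.filter fun i =>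
          ε i && (![t₁, t₂, a, b, c] : Fin 5 → Fin ((3 * (k + 2) + 2) + (3 * (k + 2) + 2)) → Bool) i j))) := by
      have e8 : (2 : ℤ) ^ 3 = 8 := by norm_num
      rw [e8] at h8; exact h8
    have h8' : (8 : ℤ) ∣ ∑ ε : Fin 5 → Bool, (u (fun j => x j ^^ decide (Odd #(univ.filter fun i =>
          ε i && (![t₁, t₂, a, b, c] : Fin 5 → Fin ((3 * (k + 2) + 2) + (3 * (k + 2) + 2)) → Bool) i j))) -
        2 ^ (k + 2) * sZ (f (fun j => x j ^^ decide (Odd #(univ.filter fun i =>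
          ε i && (![t₁, t₂, a, b, c] : Fin 5 → Fin ((3 * (k + 2) + 2) + (3 * (k + 2) + 2)) → Bool) i j))))) := by
      rw [sum_sub_distrib, hzf']
      exact dvd_sub h8n (Dvd.intro _ rfl)
    rw [hloc x ![a, b, c] hin, ← mul_sum] at h8'
    obtain ⟨k8, hk8⟩ := h8'
    exact ⟨k8, by linarith⟩
  · intro x hx a₀ a₁ a₂ a₃ ha₀ ha₁ ha₂ ha₃
    have hin : ∀ ε : Fin 4 → Bool, (fun j => x j ^^ decide (Odd #(univ.filter fun i =>
        ε i && (![a₀, a₁, a₂, a₃] : Fin 4 → Fin ((3 * (k + 2) + 2) + (3 * (k + 2) + 2)) → Bool) i j))) ∈ S :=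
      fun ε => fr_mem_flatPt4 V₀ h0 (· ∈ S) hPV hx ![a₀, a₁, a₂, a₃] (fun i => by fin_cases i <;> assumption) ε
    have h16 := fs_flat_sum_dvd (e := 4) g u hg hu x ![t₁, t₂, a₀, a₁, a₂, a₃] (by omega)
    obtain ⟨zf, hzf⟩ := sl_sum_sZ_flat f hf x ![t₁, t₂, a₀, a₁, a₂, a₃]
    have hzf' : ∑ ε : Fin 6 → Bool, 2 ^ (k + 2) * sZ (f (fun j => x j ^^ decide (Odd #(univ.filter fun i =>
          ε i && (![t₁, t₂, a₀, a₁, a₂, a₃] : Fin 6 → Fin ((3 * (k + 2) + 2) + (3 * (k + 2) + 2)) → Bool) i j)))) =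
        16 * (2 ^ k * zf) := by
      rw [← mul_sum, hzf]; norm_num; ring
    have h16n : (16 : ℤ) ∣ ∑ ε : Fin 6 → Bool, u (fun j => x j ^^ decide (Odd #(univ.filter fun i =>
          ε i && (![t₁, t₂, a₀, a₁, a₂, a₃] : Fin 6 → Fin ((3 * (k + 2) + 2) + (3 * (k + 2) + 2)) → Bool) i j))) := by
      have e16 : (2 : ℤ) ^ 4 = 16 := by norm_num
      rw [e16] at h16; exact h16
    have h16' : (16 : ℤ) ∣ ∑ ε : Fin 6 → Bool, (u (fun j => x j ^^ decide (Odd #(univ.filter fun i =>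
          ε i && (![t₁, t₂, a₀, a₁, a₂, a₃] : Fin 6 → Fin ((3 * (k + 2) + 2) + (3 * (k + 2) + 2)) → Bool) i j))) -
        2 ^ (k + 2) * sZ (f (fun j => x j ^^ decide (Odd #(univ.filter fun i =>
          ε i && (![t₁, t₂, a₀, a₁, a₂, a₃] : Fin 6 → Fin ((3 * (k + 2) + 2) + (3 * (k + 2) + 2)) → Bool) i j))))) := by
      rw [sum_sub_distrib, hzf']
      exact dvd_sub h16n (Dvd.intro _ rfl)
    rw [hloc x ![a₀, a₁, a₂, a₃] hin, ← mul_sum] at h16'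
    obtain ⟨k16, hk16⟩ := h16'
    exact ⟨k16, by linarith⟩

/-- **Configuration (sA) is empty (`r ≥ 3`).**  For cubic `f, g : 𝔽₂^{(3r+2)+(3r+2)} → 𝔽₂` with `W_g = 2^{2r+2}u`, a non-constant parity
`[u odd]`, the budget identity `2^{8r+5}(1−Φ) = 2^{6r+4}`, the pointwise budget identity of `f2_split_trichotomy`, and digit sets `#A = N/8`,
`B' = C' = ∅`: contradiction.  Uniform in `r`; NOT summit progress. [this work] -/
theorem f2_splitA_false (r : ℕ) (hr : 3 ≤ r) (f g : (Fin ((3 * r + 2) + (3 * r + 2)) → Bool) → Bool) (hf : IsDegLeFun 3 f)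
    (hg : IsDegLeFun 3 g) (u : (Fin ((3 * r + 2) + (3 * r + 2)) → Bool) → ℤ)
    (hu : ∀ x, W (fun y => signOf (g y)) x = (2 : ℝ) ^ (2 * r + 2) * (u x : ℝ))
    (hodd : ∃ x, Odd (u x)) (heven : ∃ x, ¬ Odd (u x))
    (hTeq : (2 : ℝ) ^ (8 * r + 5) * (1 - forrelation f g) = 2 ^ (6 * r + 4))
    (hpt : ∀ x, (u x - 2 ^ r * sZ (f x)) ^ 2 = (if Odd (u x) then 1 else 0) + 4 * (if ¬ Odd (u x) ∧ Odd (u x / 2) then 1 else 0)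
      + 16 * (if ¬ Odd (u x) ∧ ¬ Odd (u x / 2) ∧ Odd (u x / 2 / 2) then 1 else 0)
      + 8 * (if Odd (u x) ∧ ¬ (Odd (u x / 2) ↔ Odd (u x / 2 / 2)) then 1 else 0))
    (hAc : #(univ.filter fun x : Fin ((3 * r + 2) + (3 * r + 2)) → Bool => ¬ Odd (u x) ∧ Odd (u x / 2)) = 2 ^ (6 * r + 1))
    (hB0 : #(univ.filter fun x : Fin ((3 * r + 2) + (3 * r + 2)) → Bool => ¬ Odd (u x) ∧ ¬ Odd (u x / 2) ∧ Odd (u x / 2 / 2)) = 0)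
    (hC0 : #(univ.filter fun x : Fin ((3 * r + 2) + (3 * r + 2)) → Bool => Odd (u x) ∧ ¬ (Odd (u x / 2) ↔ Odd (u x / 2 / 2))) = 0) :
    False := by
  classical
  have hd0 : IsDegLeFun 1 (fun x => decide (Odd (u x))) := f2_digitZero r g u hg hu
  have hd1 : IsDegLeFun 2 (fun x => decide (Odd (u x / 2))) := f2_digitOne r g u hg hu
  have hLc : #(univ.filter fun x : Fin ((3 * r + 2) + (3 * r + 2)) → Bool => Odd (u x)) = 2 ^ (6 * r + 3) :=
    f2_card_odd_of_split r g u hg hu hodd heven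
  obtain ⟨k, rfl⟩ : ∃ k, r = k + 3 := ⟨r - 3, by omega⟩
  have hB : ∀ x, ¬ Odd (u x) → ¬ Odd (u x / 2) → ¬ Odd (u x / 2 / 2) := by
    intro x hx h2 h3
    exact filter_eq_empty_iff.1 (card_eq_zero.1 hB0) (mem_univ x) ⟨hx, h2, h3⟩
  have hC : ∀ x, Odd (u x) → (Odd (u x / 2) ↔ Odd (u x / 2 / 2)) := by
    intro x hx
    by_contra h
    exact filter_eq_empty_iff.1 (card_eq_zero.1 hC0) (mem_univ x) ⟨hx, h⟩
  set A := univ.filter (fun x : Fin ((3 * (k + 3) + 2) + (3 * (k + 3) + 2)) → Bool => ¬ Odd (u x) ∧ Odd (u x / 2)) with hAdef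
  have hmemA : ∀ x, x ∈ A ↔ ¬ Odd (u x) ∧ Odd (u x / 2) := fun x => by simp [hAdef]
  have h4c : ∀ x, (4 : ℤ) ∣ 2 ^ (k + 3) * sZ (f x) := fun x => ⟨2 ^ (k + 1) * sZ (f x), by ring⟩
  have hpow2 : (2 : ℤ) ^ (k + 3) = 2 * 2 ^ (k + 2) := by ring
  -- the residual
  have hτL : ∀ x, Odd (u x) → u x - 2 ^ (k + 3) * sZ (f x) = sZ (decide (Odd (u x / 2))) := by
    intro x hx
    have h := hpt x
    rw [if_pos hx, if_neg (fun h => h.1 hx), if_neg (fun h => h.1 hx), if_neg (fun h => h.2 (hC x hx))] at h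
    have h1 : (u x - 2 ^ (k + 3) * sZ (f x)) * (u x - 2 ^ (k + 3) * sZ (f x)) = 1 := by rw [← pow_two]; linarith
    exact z2_tau_one (h4c x) (mul_self_eq_one_iff.1 h1)
  have hτA : ∀ x, x ∈ A → (u x - 2 ^ (k + 3) * sZ (f x)) ^ 2 = 4 := by
    intro x hxA
    have hx := (hmemA x).1 hxA
    have h := hpt x
    rw [if_neg hx.1, if_pos hx, if_neg (fun h => h.2.1 hx.2), if_neg (fun h => hx.1 h.1)] at h
    linarith
  have hτ0 : ∀ x, ¬ Odd (u x) → x ∉ A → u x - 2 ^ (k + 3) * sZ (f x) = 0 := by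
    intro x hx hxA
    have h2 : ¬ Odd (u x / 2) := fun h => hxA ((hmemA x).2 ⟨hx, h⟩)
    have h := hpt x
    rw [if_neg hx, if_neg (fun h => hxA ((hmemA x).2 h)), if_neg (fun h => hB x hx h2 h.2.2), if_neg (fun h => hx h.1)] at h
    have h' : (u x - 2 ^ (k + 3) * sZ (f x)) ^ 2 = 0 := by linarith
    exact (pow_eq_zero_iff two_ne_zero).1 h'
  -- `A` is an `(n−3)`-flat
  have hdegA : IsDegLeFun (2 + 1) (fun x => (decide (Odd (u x)) ^^ true) && decide (Odd (u x / 2))) :=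
    bb_deg_and (tb_isDegLeFun_xor_const hd0 true) hd1 (by norm_num)
  have hsetA : (univ.filter fun x : Fin ((3 * (k + 3) + 2) + (3 * (k + 3) + 2)) → Bool =>
      ((decide (Odd (u x)) ^^ true) && decide (Odd (u x / 2))) = true) = A := by
    rw [hAdef]; exact filter_congr fun x _ => by simp
  have hmwA := mw_flat_of_minweight 2 _ hdegA (by rw [hsetA, hAc]; ring)
  rw [hsetA] at hmwA
  obtain ⟨h0A, haddA, hcardVA, hcosetA⟩ := hmwA
  set VA := univ.filter (fun a : Fin ((3 * (k + 3) + 2) + (3 * (k + 3) + 2)) → Bool => ∀ x,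
    ((decide (Odd (u (bxor x a))) ^^ true) && decide (Odd (u (bxor x a) / 2))) =
      ((decide (Odd (u x)) ^^ true) && decide (Odd (u x / 2)))) with hVA
  rw [hAc] at hcardVA
  have hApos : 0 < #A := by rw [hAc]; exact Nat.two_pow_pos _
  obtain ⟨xA, hxA⟩ : A.Nonempty := card_pos.1 hApos
  have hSA : A = VA.image (bxor xA) := hcosetA xA (by have h := (hmemA xA).1 hxA; simp [h.1, h.2])
  have hperAfun : ∀ a ∈ VA, ∀ x, ((decide (Odd (u (bxor x a))) ^^ true) && decide (Odd (u (bxor x a) / 2))) =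
      ((decide (Odd (u x)) ^^ true) && decide (Odd (u x / 2))) := fun a ha => (mem_filter.1 ha).2
  -- `L` : periods of `d₀`
  have hfiltL : (univ.filter fun x : Fin ((3 * (k + 3) + 2) + (3 * (k + 3) + 2)) → Bool => decide (Odd (u x)) = true) =
      univ.filter fun x => Odd (u x) := filter_congr fun x _ => by simp
  have hd0' : IsDegLeFun (0 + 1) (fun x => decide (Odd (u x))) := hd0
  have hmwL := mw_flat_of_minweight 0 _ hd0' (by rw [hfiltL, hLc]; ring)
  obtain ⟨h0L, haddL, hcardVL, -⟩ := hmwL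
  rw [hfiltL, hLc] at hcardVL
  set VL := univ.filter (fun a : Fin ((3 * (k + 3) + 2) + (3 * (k + 3) + 2)) → Bool => ∀ x,
    decide (Odd (u (bxor x a))) = decide (Odd (u x))) with hVL
  have hperL : ∀ a ∈ VL, ∀ x, decide (Odd (u (bxor x a))) = decide (Odd (u x)) := fun a ha => (mem_filter.1 ha).2
  -- `V_A ⊆ V_L`
  have hVAL : ∀ a ∈ VA, ∀ x, decide (Odd (u (bxor x a))) = decide (Odd (u x)) := by
    intro a ha x
    have hxa : bxor xA a ∈ A := fl1_coset_vadd haddA hSA hxA ha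
    have hc := tc_const_of_deg_zero (stub_derivDegree ((3 * (k + 3) + 2) + (3 * (k + 3) + 2)) 0 (fun x => decide (Odd (u x))) a hd0)
      x xA
    have e1 : decide (Odd (u xA)) = false := decide_eq_false ((hmemA xA).1 hxA).1
    have e2 : decide (Odd (u (bxor xA a))) = false := decide_eq_false ((hmemA _).1 hxa).1
    simp only [e1, e2] at hc
    revert hc; cases decide (Odd (u (bxor x a))) <;> cases decide (Odd (u x)) <;> decide
  -- on `H`, `d₁` is `V_A`-periodic
  have hqH : ∀ a ∈ VA, ∀ h, decide (Odd (u h)) = false → decide (Odd (u (bxor h a) / 2)) = decide (Odd (u h / 2)) := by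
    intro a ha h hh
    have hha : decide (Odd (u (bxor h a))) = false := by rw [hVAL a ha h]; exact hh
    have key := hperAfun a ha h
    rw [hh, hha] at key
    simpa using key
  obtain ⟨xH, hxH⟩ := heven
  have hxH' : decide (Odd (u xH)) = false := decide_eq_false hxH
  -- two directions in `V_L` transversal to `V_A`
  obtain ⟨t₁, ht₁L, t₂, ht₂L, ht₁, ht₂, -, ht₂₁⟩ := fl1_dirs2 VL VA (by
    rw [hcardVA, hcardVL]
    have e : (2 : ℕ) ^ (6 * (k + 3) + 3) = 4 * 2 ^ (6 * (k + 3) + 1) := by ring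
    rw [e]; have hX : 0 < 2 ^ (6 * (k + 3) + 1) := Nat.two_pow_pos _; linarith)
  -- the `A`-piece `e = u/2 − 2^{r-1} s`
  set eA : (Fin ((3 * (k + 3) + 2) + (3 * (k + 3) + 2)) → Bool) → ℤ := fun x => u x / 2 - 2 ^ (k + 2) * sZ (f x) with heAdef
  have hFe : ∀ p ∈ A, u p - 2 ^ (k + 3) * sZ (f p) = 2 * eA p := by
    intro p hp
    obtain ⟨m, hm⟩ := Int.not_odd_iff_even.1 ((hmemA p).1 hp).1
    simp only [eA]
    rw [hm, show m + m = 2 * m by ring, Int.mul_ediv_cancel_left m (by norm_num : (2 : ℤ) ≠ 0), hpow2]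
    ring
  have heA : ∀ p ∈ A, eA p = 1 ∨ eA p = -1 := by
    intro p hp
    have h4 := hτA p hp
    rw [hFe p hp] at h4
    have h1 : eA p * eA p = 1 := by nlinarith
    exact mul_self_eq_one_iff.1 h1
  have hH_of : ∀ p ∈ A, ∀ t ∈ VL, ¬ Odd (u (bxor p t)) := by
    intro p hp t ht hodd'
    have := hperL t ht p
    rw [decide_eq_false ((hmemA p).1 hp).1] at this
    exact absurd hodd' (by simpa using this)
  have hz : ∀ p ∈ A, ∀ t ∈ VL, t ∉ VA → u (bxor p t) - 2 ^ (k + 3) * sZ (f (bxor p t)) = 0 :=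
    fun p hp t ht htA => hτ0 _ (hH_of p hp t ht) (fl1_coset_out h0A haddA hSA hp htA)
  obtain ⟨H3, H4⟩ := f2_H34 (k + 3) (by omega) f g hf hg u hu VA A xA h0A haddA hSA eA t₁ t₂ hFe
    (fun p hp => hz p hp t₁ ht₁L ht₁) (fun p hp => hz p hp t₂ ht₂L ht₂) (fun p hp => by
      rw [iw_bxor_assoc]; exact hz p hp _ (haddL _ ht₂L _ ht₁L) ht₂₁)
  have hE := fl1_flat_l1 VA A xA h0A haddA hSA eA heA H3 H4
  set AA : (Fin ((3 * (k + 3) + 2) + (3 * (k + 3) + 2)) → Bool) → ℝ := fun x => if x ∈ A then (eA x : ℝ) else 0 with hAA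
  have hN : (2 : ℝ) ^ ((3 * (k + 3) + 2) + (3 * (k + 3) + 2)) = 2 ^ (6 * k + 22) := by ring
  have hYle : ∑ y, |W AA y| ≤ 2 * (2 : ℝ) ^ (6 * k + 22) := by
    have hnn : 0 ≤ ∑ y, |W AA y| := sum_nonneg fun y _ => abs_nonneg _
    rw [hN] at hE
    have h2 : (∑ y, |W AA y|) ^ 2 ≤ (2 * (2 : ℝ) ^ (6 * k + 22)) ^ 2 := hE.trans_eq (by ring)
    exact (pow_le_pow_iff_left₀ hnn (by positivity) two_ne_zero).1 h2
  -- the `L`-piece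
  set AL : (Fin ((3 * (k + 3) + 2) + (3 * (k + 3) + 2)) → Bool) → ℝ :=
    fun x => if decide (Odd (u x)) = true then signOf (decide (Odd (u x / 2))) else 0 with hAL
  have hL := sp_L_l1 (fun x => decide (Odd (u x))) (fun x => decide (Odd (u x / 2))) hd0 hd1 VA h0A haddA hVAL hqH hxH'
  rw [hcardVA, hfiltL, hLc, hN] at hL
  have hXle : ∑ y, |W AL y| ≤ 2 * (2 : ℝ) ^ (6 * k + 22) := by
    have hnn : 0 ≤ ∑ y, |W AL y| := sum_nonneg fun y _ => abs_nonneg _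
    have hposA : (0 : ℝ) < ((2 ^ (6 * (k + 3) + 1) : ℕ) : ℝ) := by positivity
    have h3 : (∑ y, |W AL y|) ^ 2 * ((2 ^ (6 * (k + 3) + 1) : ℕ) : ℝ) ≤
        (2 * (2 : ℝ) ^ (6 * k + 22)) ^ 2 * ((2 ^ (6 * (k + 3) + 1) : ℕ) : ℝ) := by
      refine hL.trans_eq ?_
      push_cast
      ring
    have h2 := le_of_mul_le_mul_right h3 hposA
    exact (pow_le_pow_iff_left₀ hnn (by positivity) two_ne_zero).1 h2
  -- decomposition of the residual
  have hdecomp : (fun x => (u x : ℝ) - (2 : ℝ) ^ (k + 3) * signOf (f x)) = fun x => AL x + 2 * AA x := by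
    funext x
    have e : (u x : ℝ) - (2 : ℝ) ^ (k + 3) * signOf (f x) = (((u x - 2 ^ (k + 3) * sZ (f x) : ℤ)) : ℝ) := by
      push_cast; rw [tp_sZ_cast]
    rw [e]
    by_cases hx : Odd (u x)
    · have hxA' : x ∉ A := fun h => ((hmemA x).1 h).1 hx
      simp only [AL, AA, if_pos (decide_eq_true hx), if_neg hxA']
      rw [hτL x hx, tp_sZ_cast]; ring
    · have hdx : ¬ decide (Odd (u x)) = true := by simpa using hx
      by_cases hxA' : x ∈ A
      · simp only [AL, AA, if_neg hdx, if_pos hxA']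
        rw [hFe x hxA']; push_cast; ring
      · simp only [AL, AA, if_neg hdx, if_neg hxA']
        rw [hτ0 x hx hxA']; norm_num
  -- pairing
  have hpair := fms_pairing (k + 3) f g u hu
  rw [hdecomp] at hpair
  have e2 : ∀ y, signOf (g y) * W (fun x => AL x + 2 * AA x) y =
      signOf (g y) * W AL y + 2 * (signOf (g y) * W AA y) := fun y => by
    rw [sp_W_add, fl1_W_smul]; ring
  rw [sum_congr rfl fun y _ => e2 y, sum_add_distrib, ← mul_sum,
    show (2 : ℝ) ^ (10 * (k + 3) + 6) = 2 ^ (2 * k + 7) * 2 ^ (8 * (k + 3) + 5) by ring, mul_assoc, hTeq] at hpair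
  have hPL : ∑ y, signOf (g y) * W AL y ≤ ∑ y, |W AL y| := fl1_pairing_le_l1 g (W AL)
  have hPA : ∑ y, signOf (g y) * W AA y ≤ ∑ y, |W AA y| := fl1_pairing_le_l1 g (W AA)
  have hbig : (8 : ℝ) * 2 ^ (6 * k + 22) ≤ 2 ^ (2 * k + 7) * 2 ^ (6 * (k + 3) + 4) := by
    have e8 : (2 : ℝ) ^ (2 * k + 7) * 2 ^ (6 * (k + 3) + 4) = 2 ^ (2 * k + 4) * (8 * 2 ^ (6 * k + 22)) := by ring
    rw [e8]
    have h1 : (1 : ℝ) ≤ 2 ^ (2 * k + 4) := one_le_pow₀ (by norm_num)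
    have h2 : (0 : ℝ) ≤ 8 * 2 ^ (6 * k + 22) := by positivity
    exact le_mul_of_one_le_left h2 h1
  have hpos : (0 : ℝ) < 2 ^ (6 * k + 22) := by positivity
  linarith

end Summit.QuantumAdvantage.QuantumAdvantage.Theorems.CubicForrelation.NearExactIsExact

end
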